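import Summits.AtomisticToContinuum.FouriersLaw.Theorems.EmbeddedDrudeMourreDrudeDissolutionStubWickShellStaticWickCovarianceAlgebra
import Literature.MathematicalPhysics.KineticTheory.HarmonicChaosDecomposition
import HarnessLib

/-!
# Wick's theorem for Wick products from Stein's recursion (helper `wickCovariance_of_stein` of stub K2
`stub_wickShellStatic`, line `gram-pencil-harmonic-chaos`, crux `EmbeddedDrudeMourre.DrudeDissolution`,
item stmt-AtomisticToContinuum-12593; `--supports` file, closes nothing)

WHAT. For a probability measure `μ` on `ChainConfig` in which all products of the linear observables
`φ(f) = linObs f` are integrable (INT), centred (MEAN: `∫ φ(f₀) dμ = 0`) and satisfy STEIN'S RECURSION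
`∫ φ(f₀) Π_i φ(f_i) dμ = Σ_i C_T(f₀, f_i) ∫ Π_{j ≠ i} φ(f_j) dμ` with the thermal covariance
`C_T = thermalCov ω₂ T`, the Wick products `wick ω₂ T N f = :φ(f_0) ⋯ φ(f_{N-1}):` (Janson's recursion,
`HarmonicChaosDecomposition.lean` §4) satisfy WICK'S THEOREM (Janson 1997, Thm 3.9): products of two Wick
products are integrable, `∫ :φ(f_0) ⋯ φ(f_N): dμ = 0`, Wick products of different degrees are orthogonal,
and `∫ :Π φ(f_i): :Π φ(g_i): dμ = Σ_{π ∈ S_N} Π_i C_T(f_i, g_{π i})` (`wickCovariance_of_stein`).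

HOW. The algebra is the companion file `…WickCovarianceAlgebra.lean` (Wick polynomials `W N f` and
contraction derivations `∂_h` of the free commutative algebra `R = MvPolynomial TestFn ℝ`, and the
consequences of Stein's identity `Λ (X_h p) = Λ (∂_h p)` for a linear functional `Λ`). Here:
the evaluation `ev = MvPolynomial.aeval linObs : R →ₐ[ℝ] (ChainConfig → ℝ)` maps `W N f` to `wick ω₂ T N f`
(`aeval_wickPoly`); every `ev p` is integrable (`integrable_aeval`, from INT by induction on `p`), so
`Λ p = ∫ ev p dμ` is a linear functional (`exists_expect`); it satisfies Stein's identity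
(`expect_X_mul`: by linearity from products of generators, where it is exactly STEIN, resp. MEAN for the
empty product); the four conclusions are then the abstract ones transported through `ev`.

References: S. Janson, Gaussian Hilbert Spaces (1997), Thm 3.9. [cite: Janson1997, Thm 3.9]
-/

noncomputable section

namespace Summit.AtomisticToContinuum.FouriersLaw.Theorems.DrudeDissolution.GramPencilHarmonicChaos

open MeasureTheory Filter Set Function Topology
open scoped InnerProductSpace ENNReal ComplexConjugate
open Literature.MathematicalPhysics.KineticTheory
open Literature.MathematicalPhysics.KineticTheory.HeatConduction
open HarmonicChaos ProbabilityTheory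

section Transfer

variable {ω₂ T : ℝ} {μ : Measure ChainConfig}
  {W : (N : ℕ) → (Fin N → TestFn) → MvPolynomial TestFn ℝ}
  {D : TestFn → Derivation ℝ (MvPolynomial TestFn ℝ) (MvPolynomial TestFn ℝ)}
  {Λ : MvPolynomial TestFn ℝ →ₗ[ℝ] ℝ}

/-- The evaluation `X_h ↦ φ(h)` sends the Wick polynomial with contraction `C_T` to the Wick product
`:φ(f_0) ⋯ φ(f_{N-1}):`. [cite: Janson1997, Thm 3.15] -/
theorem aeval_wickPoly
    (hW : (∀ f, W 0 f = 1) ∧ (∀ f, W 1 f = MvPolynomial.X (f 0)) ∧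
      ∀ (N : ℕ) (f : Fin (N + 2) → TestFn), W (N + 2) f =
        MvPolynomial.X (f 0) * W (N + 1) (Fin.tail f) -
          ∑ i, thermalCov ω₂ T (f 0) (f i.succ) • W N (Fin.removeNth i (Fin.tail f))) :
    ∀ (N : ℕ) (f : Fin N → TestFn), MvPolynomial.aeval linObs (W N f) = wick ω₂ T N f
  | 0, f => by ext σ; simp [hW.1]
  | 1, f => by simp [hW.2.1]
  | N + 2, f => by
      ext σ
      rw [hW.2.2]
      simp only [wick, map_sub, map_mul, map_sum, map_smul, MvPolynomial.aeval_X,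
        aeval_wickPoly hW (N + 1), aeval_wickPoly hW N]
      simp [Finset.sum_apply, smul_eq_mul]

/-- Integrability of `ev p · Π_j φ(G j)` for every `p ∈ R`, from integrability of all products of
linear observables (induction on `p`). [folklore] -/
theorem integrable_aeval_mul_prod [IsFiniteMeasure μ]
    (hINT : ∀ (N : ℕ) (f : Fin N → TestFn), Integrable (fun σ : ChainConfig => ∏ i, linObs (f i) σ) μ)
    (p : MvPolynomial TestFn ℝ) :
    ∀ (m : ℕ) (G : Fin m → TestFn),
      Integrable (fun σ : ChainConfig => MvPolynomial.aeval linObs p σ * ∏ j, linObs (G j) σ) μ := by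
  induction p using MvPolynomial.induction_on with
  | C a =>
      intro m G
      simpa using (hINT m G).const_mul a
  | add p q hp hq =>
      intro m G
      simpa [Pi.add_def, add_mul] using (hp m G).add (hq m G)
  | mul_X p n hp =>
      intro m G
      simpa [Fin.prod_univ_succ, mul_assoc] using hp (m + 1) (Fin.cons n G)

/-- Integrability of `ev p` for every `p ∈ R`. [folklore] -/
theorem integrable_aeval [IsFiniteMeasure μ]
    (hINT : ∀ (N : ℕ) (f : Fin N → TestFn), Integrable (fun σ : ChainConfig => ∏ i, linObs (f i) σ) μ)
    (p : MvPolynomial TestFn ℝ) : Integrable (MvPolynomial.aeval linObs p) μ := by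
  simpa using integrable_aeval_mul_prod hINT p 0 Fin.elim0

/-- The expectation `p ↦ ∫ ev p dμ` is a linear functional on `R` as soon as every `ev p` is
integrable. [folklore] -/
theorem exists_expect (hI : ∀ p : MvPolynomial TestFn ℝ, Integrable (MvPolynomial.aeval linObs p) μ) :
    ∃ Λ : MvPolynomial TestFn ℝ →ₗ[ℝ] ℝ, ∀ p, Λ p = ∫ σ, MvPolynomial.aeval linObs p σ ∂μ :=
  ⟨{ toFun := fun p => ∫ σ, MvPolynomial.aeval linObs p σ ∂μ
     map_add' := fun p q => by
       simp only [map_add, Pi.add_apply]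
       exact integral_add (hI p) (hI q)
     map_smul' := fun c p => by
       simp only [map_smul, Pi.smul_apply, smul_eq_mul, RingHom.id_apply]
       exact integral_const_mul c _ }, fun _ => rfl⟩

/-- **Stein's identity in the free algebra**: `Λ (X_h · p) = Λ (∂_h p)` for `Λ = ∫ ev · dμ` and every
`p ∈ R` (by linearity from products of generators, where it is the hypothesis STEIN, resp. MEAN for the
empty product). [cite: Janson1997, Thm 3.9] -/
theorem expect_X_mul (hΛ : ∀ p, Λ p = ∫ σ, MvPolynomial.aeval linObs p σ ∂μ)
    (hD : ∀ h g, D h (MvPolynomial.X g) = thermalCov ω₂ T h g • (1 : MvPolynomial TestFn ℝ))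
    (hMEAN : ∀ f₀ : TestFn, ∫ σ, linObs f₀ σ ∂μ = 0)
    (hSTEIN : ∀ (N : ℕ) (f₀ : TestFn) (f : Fin (N + 1) → TestFn),
        ∫ σ, linObs f₀ σ * ∏ i, linObs (f i) σ ∂μ =
          ∑ i : Fin (N + 1), thermalCov ω₂ T f₀ (f i) *
            ∫ σ, ∏ j : Fin N, linObs (Fin.removeNth i f j) σ ∂μ)
    (h₀ : TestFn) (p : MvPolynomial TestFn ℝ) :
    Λ (MvPolynomial.X h₀ * p) = Λ (D h₀ p) := by
  suffices H : ∀ (m : ℕ) (G : Fin m → TestFn),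
      Λ (MvPolynomial.X h₀ * ((∏ j, MvPolynomial.X (G j)) * p)) =
        Λ (D h₀ ((∏ j, MvPolynomial.X (G j)) * p)) by
    simpa using H 0 Fin.elim0
  induction p using MvPolynomial.induction_on with
  | C a =>
      intro m G
      cases m with
      | zero =>
          simp only [Finset.univ_eq_empty, Finset.prod_empty, one_mul, MvPolynomial.derivation_C,
            map_zero]
          rw [mul_comm, ← MvPolynomial.smul_eq_C_mul, map_smul, hΛ, MvPolynomial.aeval_X, hMEAN,
            smul_zero]
      | succ k =>
          rw [mul_comm _ (MvPolynomial.C a), ← MvPolynomial.smul_eq_C_mul, mul_smul_comm, map_smul,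
            Derivation.map_smul, map_smul, contractionDeriv_prod_X hD, map_sum]
          congr 1
          simp only [map_smul, smul_eq_mul]
          simp only [hΛ, map_mul, map_prod, MvPolynomial.aeval_X, Pi.mul_apply, Finset.prod_apply]
          exact hSTEIN k h₀ G
  | add p q hp hq =>
      intro m G
      simp only [mul_add, map_add, hp m G, hq m G]
  | mul_X p n hp =>
      intro m G
      have e : (∏ j, MvPolynomial.X (G j)) * (p * MvPolynomial.X n) =
          (∏ j, MvPolynomial.X ((Fin.cons n G : Fin (m + 1) → TestFn) j)) * p := by
        rw [Fin.prod_univ_succ]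
        simp only [Fin.cons_zero, Fin.cons_succ]
        ring
      rw [e]
      exact hp (m + 1) (Fin.cons n G)

end Transfer

/-- **Wick's theorem for Wick products from Stein's recursion** (abstract in the state): if under the
probability measure `μ` all products of linear observables are integrable, centred, and satisfy Stein's
recursion `∫ φ(f₀) Π_i φ(f_i) = Σ_i C_T(f₀, f_i) ∫ Π_{j ≠ i} φ(f_j)`, then (i) products of two Wick products
are integrable, (ii) `∫ :φ(f_0) ⋯ φ(f_N): dμ = 0`, (iii) Wick products of different degrees are orthogonal,
(iv) `∫ :Π_i φ(f_i): :Π_i φ(g_i): dμ = Σ_{π ∈ S_N} Π_i C_T(f_i, g_{π i})`. [cite: Janson1997, Thm 3.9] -/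
theorem wickCovariance_of_stein :
    ∀ (ω₂ T : ℝ) (μ : MeasureTheory.Measure ChainConfig), MeasureTheory.IsProbabilityMeasure μ →
      (∀ (N : ℕ) (f : Fin N → TestFn), MeasureTheory.Integrable (fun σ : ChainConfig => ∏ i, linObs (f i) σ) μ) →
      (∀ f₀ : TestFn, ∫ σ, linObs f₀ σ ∂μ = 0) →
      (∀ (N : ℕ) (f₀ : TestFn) (f : Fin (N + 1) → TestFn),
          ∫ σ, linObs f₀ σ * ∏ i, linObs (f i) σ ∂μ =
            ∑ i : Fin (N + 1), thermalCov ω₂ T f₀ (f i) * ∫ σ, ∏ j : Fin N, linObs (Fin.removeNth i f j) σ ∂μ) →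
      (∀ (N M : ℕ) (f : Fin N → TestFn) (g : Fin M → TestFn),
          MeasureTheory.Integrable (fun σ : ChainConfig => wick ω₂ T N f σ * wick ω₂ T M g σ) μ) ∧
      (∀ (N : ℕ) (f : Fin (N + 1) → TestFn), ∫ σ, wick ω₂ T (N + 1) f σ ∂μ = 0) ∧
      (∀ (N M : ℕ) (f : Fin N → TestFn) (g : Fin M → TestFn), N ≠ M →
          ∫ σ, wick ω₂ T N f σ * wick ω₂ T M g σ ∂μ = 0) ∧
      (∀ (N : ℕ) (f g : Fin N → TestFn),
          ∫ σ, wick ω₂ T N f σ * wick ω₂ T N g σ ∂μ =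
            ∑ π : Equiv.Perm (Fin N), ∏ i, thermalCov ω₂ T (f i) (g (π i))) := by
  intro ω₂ T μ hμ hINT hMEAN hSTEIN
  obtain ⟨W, hW⟩ := exists_wickPoly (α := TestFn) (thermalCov ω₂ T)
  obtain ⟨D, hD⟩ := exists_contractionDeriv (α := TestFn) (thermalCov ω₂ T)
  have hI : ∀ p : MvPolynomial TestFn ℝ, Integrable (MvPolynomial.aeval linObs p) μ :=
    integrable_aeval hINT
  obtain ⟨Λ, hΛ⟩ := exists_expect hI
  have hX : ∀ (h : TestFn) (p : MvPolynomial TestFn ℝ), Λ (MvPolynomial.X h * p) = Λ (D h p) :=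
    expect_X_mul hΛ hD hMEAN hSTEIN
  have hΛ1 : Λ 1 = 1 := by simp [hΛ]
  have key : ∀ (N M : ℕ) (f : Fin N → TestFn) (g : Fin M → TestFn),
      ∫ σ, wick ω₂ T N f σ * wick ω₂ T M g σ ∂μ = Λ (W N f * W M g) := by
    intro N M f g
    simp only [hΛ, map_mul, aeval_wickPoly hW, Pi.mul_apply]
  refine ⟨fun N M f g => ?_, fun N f => ?_, fun N M f g hNM => ?_, fun N f g => ?_⟩
  · have := hI (W N f * W M g)
    rw [map_mul, aeval_wickPoly hW, aeval_wickPoly hW] at this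
    exact this
  · have := func_wickPoly_succ hW hD hX N f
    rwa [hΛ, aeval_wickPoly hW] at this
  · rw [key]
    exact func_wickPoly_mul_of_ne hW hD hX N M f g hNM
  · rw [key]
    exact func_wickPoly_mul_self hW hD hX hΛ1 N f g

end Summit.AtomisticToContinuum.FouriersLaw.Theorems.DrudeDissolution.GramPencilHarmonicChaos

end
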